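import Summits.Ventures.PercRepro.RankLevelSetF

/-!
# PercRepro — C-025 on the LINE LADDER `T_p(U_{2,3} ⊕ U_{m,m})`: the arithmetic half (p9, gen 13)

`proofs/P9-S4-LINELADDER-g13.md`: on the matroid `M_{p,m} = T_p(U_{2,3} ⊕ U_{m,m})` (a 3-point line plus `m` points in
general position, truncated to rank `p`; `n = m + 3`) the two level sets of C-025 at `(p, q)` have the closed forms
(Lemma 1 there, `m ≥ p + q − 2`, `c_a = C(m, a)`)

  `#U = 4·c_{q−2} + 3·c_{q−1} + c_q`,   `#Y = Σ_{q<a<p} c_a + 3·Σ_{q≤a≤p−2} c_a + 4·Σ_{q−1≤a≤p−3} c_a`,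

and the THEOREM (line ladder) is the inequality `Φ(p,q)·#U ≤ #Y` for every `q`, `p ≥ q + 2`, `m ≥ p + q − 2`.
This file proves that inequality (`ladder_ineq`, `q ≥ 2`; `ladder_one` / `ladder_zero` for the levels
`q = 1, 0` with their own `#U`), Mathlib + the tree's `phiK` and Lemma E `phiK_succ_succ_le` only:

* the base layer `m = p + q − 2` (`base_ineq`): the Pascal square `C(K+2, u) = c_u + 2c_{u−1} + c_{u−2}` writes
  `Φ(p,q) = (A + 2B + D)/(c_{q−2} + 2c_{q−1} + c_q)` with `A, B, D` the three partial row sums, the symmetry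
  `c_a = c_{K−a}` gives `A = D` and `B + c_{q−1} = A + c_q`, and the cross-multiplied inequality is a sum of products
  of nonnegative differences (`nlinarith`);
* the step `m → m + 1` (`uC_succ`, `yC_succ`): Pascal's rule makes the counts at `(p, q, m+1)` the counts at
  `(p, q, m)` plus those at `(p−1, q−1, m)`, and Lemma E turns the lower level's inequality into the needed bound;
* induction on `q` from `q = 0` (where `#Y` is nondecreasing in `m` and the base layer is immediate).

The matroid bridge (Lemma 1 in the tree's vocabulary) is NOT here — see the note §5. Nothing here is about the
windows of S4; it is the arithmetic of one family.
-/

namespace PercRepro.LineLadder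

open Finset

/-! The counts are written out in every statement (no definitions, so that the module is a pure proof module):
`#U(q, m) = 4·C(m, q−2) + 3·C(m, q−1) + C(m, q)` and
`#Y(p, q, m) = Σ_{a ∈ [q+1, p)} C(m,a) + 3·Σ_{a ∈ [q, p−1)} C(m,a) + 4·Σ_{a ∈ [q−1, p−2)} C(m,a)`. -/

/-- Pascal's rule summed over an interval away from `0`. -/
lemma sum_choose_succ (m s t : ℕ) :
    ∑ a ∈ Ico (s + 1) (t + 1), (m + 1).choose a
      = ∑ a ∈ Ico (s + 1) (t + 1), m.choose a + ∑ a ∈ Ico s t, m.choose a := by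
  rw [← Finset.sum_Ico_add' (fun a => (m + 1).choose a) s t 1,
    ← Finset.sum_Ico_add' (fun a => m.choose a) s t 1, ← Finset.sum_add_distrib]
  refine Finset.sum_congr rfl fun a _ => ?_
  simp only [Nat.choose_succ_succ', add_comm]

/-- Pascal's rule summed over an interval starting at `0`. -/
lemma sum_choose_succ_zero (m t : ℕ) :
    ∑ a ∈ Ico 0 (t + 1), (m + 1).choose a
      = ∑ a ∈ Ico 0 (t + 1), m.choose a + ∑ a ∈ Ico 0 t, m.choose a := by
  rw [Finset.sum_eq_sum_Ico_succ_bot (by omega : 0 < t + 1),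
    Finset.sum_eq_sum_Ico_succ_bot (by omega : 0 < t + 1) (fun a => m.choose a), sum_choose_succ]
  simp only [Nat.choose_zero_right]
  ring

/-- `sum_choose_succ` with explicit bounds (`1 ≤ s`). -/
lemma sum_choose_succ' (m s t : ℕ) (hs : 1 ≤ s) :
    ∑ a ∈ Ico s t, (m + 1).choose a = ∑ a ∈ Ico s t, m.choose a + ∑ a ∈ Ico (s - 1) (t - 1), m.choose a := by
  rcases Nat.exists_eq_add_of_le hs with ⟨s', rfl⟩
  rcases t with _ | t
  · simp
  · rw [show 1 + s' = s' + 1 by omega, sum_choose_succ, Nat.add_sub_cancel, Nat.add_sub_cancel]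

/-- `sum_choose_succ_zero` with an explicit bound (`1 ≤ t`). -/
lemma sum_choose_succ_zero' (m t : ℕ) (ht : 1 ≤ t) :
    ∑ a ∈ Ico 0 t, (m + 1).choose a = ∑ a ∈ Ico 0 t, m.choose a + ∑ a ∈ Ico 0 (t - 1), m.choose a := by
  rcases Nat.exists_eq_add_of_le ht with ⟨t', rfl⟩
  rw [show 1 + t' = t' + 1 by omega, sum_choose_succ_zero, Nat.add_sub_cancel]

/-- `Ioo q p = Ico (q+1) p`. -/
lemma Ioo_eq_Ico' (q p : ℕ) : Ioo q p = Ico (q + 1) p := by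
  ext a; simp only [mem_Ioo, mem_Ico]; omega

/-! ### The step `m → m + 1` (Pascal's rule) -/

/-- `#U` at level `q + 3` on `m + 1` points = `#U` at level `q + 3` on `m` points + `#U` at level `q + 2` on `m`. -/
lemma uC_succ (r m : ℕ) : (4 * (m + 1).choose (r + 3 - 2) + 3 * (m + 1).choose (r + 3 - 1) + (m + 1).choose (r + 3) : ℕ) = (4 * (m).choose (r + 3 - 2) + 3 * (m).choose (r + 3 - 1) + (m).choose (r + 3) : ℕ) + (4 * (m).choose (r + 2 - 2) + 3 * (m).choose (r + 2 - 1) + (m).choose (r + 2) : ℕ) := by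
  simp only [show r + 3 - 2 = r + 1 by omega, show r + 3 - 1 = r + 2 by omega,
    show r + 2 - 2 = r by omega, show r + 2 - 1 = r + 1 by omega, Nat.choose_succ_succ']
  ring

/-- `#U` at level `2` on `m + 1` points = `#U` at level `2` on `m` + `(3 + m)` (the level-`1` count). -/
lemma uC_two_succ (m : ℕ) : (4 * (m + 1).choose (2 - 2) + 3 * (m + 1).choose (2 - 1) + (m + 1).choose (2) : ℕ) = (4 * (m).choose (2 - 2) + 3 * (m).choose (2 - 1) + (m).choose (2) : ℕ) + (3 + m) := by
  simp only [show (2 : ℕ) - 2 = 0 by omega, show (2 : ℕ) - 1 = 1 by omega, Nat.choose_zero_right,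
    Nat.choose_succ_succ']
  rw [Nat.choose_one_right]
  ring

/-- `#Y` at `(p, q)` on `m + 1` points = `#Y` at `(p, q)` on `m` + `#Y` at `(p − 1, q − 1)` on `m` (`q ≥ 2`, `p ≥ 3`). -/
lemma yC_succ (r s m : ℕ) :
    (∑ a ∈ Ico (r + 2 + 1) (s + 3), (m + 1).choose a + 3 * ∑ a ∈ Ico (r + 2) (s + 3 - 1), (m + 1).choose a + 4 * ∑ a ∈ Ico (r + 2 - 1) (s + 3 - 2), (m + 1).choose a : ℕ) = (∑ a ∈ Ico (r + 2 + 1) (s + 3), (m).choose a + 3 * ∑ a ∈ Ico (r + 2) (s + 3 - 1), (m).choose a + 4 * ∑ a ∈ Ico (r + 2 - 1) (s + 3 - 2), (m).choose a : ℕ) + (∑ a ∈ Ico (r + 1 + 1) (s + 2), (m).choose a + 3 * ∑ a ∈ Ico (r + 1) (s + 2 - 1), (m).choose a + 4 * ∑ a ∈ Ico (r + 1 - 1) (s + 2 - 2), (m).choose a : ℕ) := by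
  rw [sum_choose_succ' m (r + 2 + 1) (s + 3) (by omega), sum_choose_succ' m (r + 2) (s + 3 - 1) (by omega),
    sum_choose_succ' m (r + 2 - 1) (s + 3 - 2) (by omega)]
  simp only [show r + 2 + 1 = r + 3 by omega, show r + 1 + 1 = r + 2 by omega, show s + 3 - 1 = s + 2 by omega,
    show s + 2 - 1 = s + 1 by omega, show s + 3 - 2 = s + 1 by omega, show r + 1 - 1 = r by omega,
    show s + 2 - 2 = s by omega, show r + 2 - 1 = r + 1 by omega, show r + 2 + 1 - 1 = r + 2 by omega,
    show s + 1 - 1 = s by omega]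
  ring

/-- The level-`1` step: `#Y` at `(p, 1)` on `m + 1` = `#Y` at `(p, 1)` on `m` + `#Y` at `(p − 1, 0)` on `m`. -/
lemma yC_one_succ (s m : ℕ) : (∑ a ∈ Ico (1 + 1) (s + 3), (m + 1).choose a + 3 * ∑ a ∈ Ico (1) (s + 3 - 1), (m + 1).choose a + 4 * ∑ a ∈ Ico (1 - 1) (s + 3 - 2), (m + 1).choose a : ℕ) = (∑ a ∈ Ico (1 + 1) (s + 3), (m).choose a + 3 * ∑ a ∈ Ico (1) (s + 3 - 1), (m).choose a + 4 * ∑ a ∈ Ico (1 - 1) (s + 3 - 2), (m).choose a : ℕ) + (∑ a ∈ Ico (0 + 1) (s + 2), (m).choose a + 3 * ∑ a ∈ Ico (0) (s + 2 - 1), (m).choose a + 4 * ∑ a ∈ Ico (0 - 1) (s + 2 - 2), (m).choose a : ℕ) := by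
  rw [sum_choose_succ' m (1 + 1) (s + 3) (by omega), sum_choose_succ' m 1 (s + 3 - 1) (by omega),
    show (1 : ℕ) - 1 = 0 by omega, sum_choose_succ_zero' m (s + 3 - 2) (by omega)]
  simp only [show (1 : ℕ) + 1 = 2 by omega, show (0 : ℕ) + 1 = 1 by omega, show s + 3 - 1 = s + 2 by omega,
    show s + 2 - 1 = s + 1 by omega, show s + 3 - 2 = s + 1 by omega, show s + 2 - 2 = s by omega,
    show (1 : ℕ) + 1 - 1 = 1 by omega, show s + 1 - 1 = s by omega]
  ring

/-- The level-`0` count `#Y` is nondecreasing in `m`. -/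
lemma yC_zero_mono (p m : ℕ) : (∑ a ∈ Ico (0 + 1) (p), (m).choose a + 3 * ∑ a ∈ Ico (0) (p - 1), (m).choose a + 4 * ∑ a ∈ Ico (0 - 1) (p - 2), (m).choose a : ℕ) ≤ (∑ a ∈ Ico (0 + 1) (p), (m + 1).choose a + 3 * ∑ a ∈ Ico (0) (p - 1), (m + 1).choose a + 4 * ∑ a ∈ Ico (0 - 1) (p - 2), (m + 1).choose a : ℕ) := by
  have h := fun (u v : ℕ) => Finset.sum_le_sum (fun a (_ : a ∈ Ico u v) => Nat.choose_le_succ m a)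
  exact Nat.add_le_add (Nat.add_le_add (h _ _) (Nat.mul_le_mul_left 3 (h _ _))) (Nat.mul_le_mul_left 4 (h _ _))

/-! ### The base layer `m = p + q − 2`: symmetry and the Pascal square -/

/-- Reflection of a partial row sum: `Σ_{a ∈ [s, t)} C(K, a) = Σ_{a ∈ [K+1−t, K+1−s)} C(K, a)` for `t ≤ K + 1`. -/
lemma sum_choose_reflect (K s t : ℕ) (ht : t ≤ K + 1) :
    ∑ a ∈ Ico s t, K.choose a = ∑ a ∈ Ico (K + 1 - t) (K + 1 - s), K.choose a := by
  rw [← Finset.sum_Ico_reflect (fun a => K.choose a) s ht]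
  refine Finset.sum_congr rfl fun a ha => ?_
  rw [mem_Ico] at ha
  exact (Nat.choose_symm (by omega)).symm

/-- The numerator of `Φ(p, q)` at the base layer: with `K = p + q − 2` (`q = r + 2`, `p = r + s + 4`),
`Σ_{q<u<p} C(K+2, u) = A + 2B + D` for the three partial row sums of `C(K, ·)`. -/
lemma phi_num_eq (r s : ℕ) :
    ∑ u ∈ Ioo (r + 2) (r + s + 4), (2 * r + s + 4 + 2).choose u
      = ∑ a ∈ Ico (r + 3) (r + s + 4), (2 * r + s + 4).choose a
        + 2 * ∑ a ∈ Ico (r + 2) (r + s + 3), (2 * r + s + 4).choose a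
        + ∑ a ∈ Ico (r + 1) (r + s + 2), (2 * r + s + 4).choose a := by
  rw [Ioo_eq_Ico', show r + 2 + 1 = (r + 2) + 1 by rfl, show r + s + 4 = (r + s + 3) + 1 by omega,
    show 2 * r + s + 4 + 2 = (2 * r + s + 4 + 1) + 1 by omega,
    sum_choose_succ (2 * r + s + 4 + 1) (r + 2) (r + s + 3),
    show r + s + 3 = (r + s + 2) + 1 by omega, show r + 2 = (r + 1) + 1 by omega,
    sum_choose_succ (2 * r + s + 4) (r + 1 + 1) (r + s + 2 + 1),
    sum_choose_succ (2 * r + s + 4) (r + 1) (r + s + 2)]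
  ring

/-- The denominator of `Φ(p, q)` at the base layer: `C(K+2, p) = c_{q−2} + 2c_{q−1} + c_q`. -/
lemma phi_den_eq (r s : ℕ) :
    (2 * r + s + 4 + 2).choose (r + s + 4)
      = (2 * r + s + 4).choose r + 2 * (2 * r + s + 4).choose (r + 1) + (2 * r + s + 4).choose (r + 2) := by
  have h1 : (2 * r + s + 4 + 2).choose (r + s + 4)
      = (2 * r + s + 4).choose (r + s + 2) + 2 * (2 * r + s + 4).choose (r + s + 3)
        + (2 * r + s + 4).choose (r + s + 4) := by
    have a1 := Nat.choose_succ_succ' (2 * r + s + 4 + 1) (r + s + 3)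
    have a2 := Nat.choose_succ_succ' (2 * r + s + 4) (r + s + 2)
    have a3 := Nat.choose_succ_succ' (2 * r + s + 4) (r + s + 3)
    simp only [show 2 * r + s + 4 + 1 + 1 = 2 * r + s + 4 + 2 by omega, show r + s + 3 + 1 = r + s + 4 by omega,
      show r + s + 2 + 1 = r + s + 3 by omega] at a1 a2 a3
    omega
  rw [h1, ← Nat.choose_symm (show r + s + 2 ≤ 2 * r + s + 4 by omega),
    ← Nat.choose_symm (show r + s + 3 ≤ 2 * r + s + 4 by omega),
    ← Nat.choose_symm (show r + s + 4 ≤ 2 * r + s + 4 by omega)]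
  rw [show 2 * r + s + 4 - (r + s + 2) = r + 2 by omega, show 2 * r + s + 4 - (r + s + 3) = r + 1 by omega,
    show 2 * r + s + 4 - (r + s + 4) = r by omega]
  ring

/-! ### The base layer: the inequality at `m = p + q − 2`, `q ≥ 2` -/

/-- THE BASE LAYER (`q = r + 2`, `p = r + s + 4`, `m = K = p + q − 2 = 2r + s + 4`): `Φ(p,q)·#U ≤ #Y`. -/
lemma base_ineq (r s : ℕ) :
    phiK (r + s + 4) (r + 2) * ((4 * (2 * r + s + 4).choose (r + 2 - 2) + 3 * (2 * r + s + 4).choose (r + 2 - 1) + (2 * r + s + 4).choose (r + 2) : ℕ) : ℚ) ≤ (∑ a ∈ Ico (r + 2 + 1) (r + s + 4), (2 * r + s + 4).choose a + 3 * ∑ a ∈ Ico (r + 2) (r + s + 4 - 1), (2 * r + s + 4).choose a + 4 * ∑ a ∈ Ico (r + 2 - 1) (r + s + 4 - 2), (2 * r + s + 4).choose a : ℕ) := by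
  -- the three partial row sums and the three binomials
  set K := 2 * r + s + 4 with hK
  set A := ∑ a ∈ Ico (r + 3) (r + s + 4), K.choose a with hA
  set B := ∑ a ∈ Ico (r + 2) (r + s + 3), K.choose a with hB
  set D := ∑ a ∈ Ico (r + 1) (r + s + 2), K.choose a with hD
  set c2 := K.choose r with hc2
  set c1 := K.choose (r + 1) with hc1
  set c0 := K.choose (r + 2) with hc0
  -- Φ at the base layer
  have hnum : ∑ u ∈ Ioo (r + 2) (r + s + 4), (K + 2).choose u = A + 2 * B + D := phi_num_eq r s
  have hden : (K + 2).choose (r + s + 4) = c2 + 2 * c1 + c0 := phi_den_eq r s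
  have hphi : phiK (r + s + 4) (r + 2) = ((A + 2 * B + D : ℕ) : ℚ) / ((c2 + 2 * c1 + c0 : ℕ) : ℚ) := by
    unfold phiK
    rw [show r + s + 4 + (r + 2) = K + 2 by omega, ← hden, ← hnum, Nat.cast_sum]
  -- the counts at the base layer
  have hU : (4 * (K).choose (r + 2 - 2) + 3 * (K).choose (r + 2 - 1) + (K).choose (r + 2) : ℕ) = 4 * c2 + 3 * c1 + c0 := by
    simp only [show r + 2 - 2 = r by omega, show r + 2 - 1 = r + 1 by omega]
    rfl
  have hY : (∑ a ∈ Ico (r + 2 + 1) (r + s + 4), (K).choose a + 3 * ∑ a ∈ Ico (r + 2) (r + s + 4 - 1), (K).choose a + 4 * ∑ a ∈ Ico (r + 2 - 1) (r + s + 4 - 2), (K).choose a : ℕ) = A + 3 * B + 4 * D := by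
    simp only [show r + 2 + 1 = r + 3 by omega, show r + s + 4 - 1 = r + s + 3 by omega,
      show r + 2 - 1 = r + 1 by omega, show r + s + 4 - 2 = r + s + 2 by omega]
    rfl
  -- the two symmetries
  have hAD : A = D := by
    rw [hA, hD, sum_choose_reflect K (r + 3) (r + s + 4) (by omega)]
    rw [show K + 1 - (r + s + 4) = r + 1 by omega, show K + 1 - (r + 3) = r + s + 2 by omega]
  have hsym : K.choose (r + s + 3) = c1 := by
    rw [hc1, ← Nat.choose_symm (show r + 1 ≤ K by omega), show K - (r + 1) = r + s + 3 by omega]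
  have hBA : B + c1 = A + c0 := by
    rw [hB, hA, Finset.sum_eq_sum_Ico_succ_bot (show r + 2 < r + s + 3 by omega),
      Finset.sum_Ico_succ_top (show r + 3 ≤ r + s + 3 by omega), hsym, hc0]
    ring
  -- monotonicity of the binomials below the middle, and `A ≥ c₁`
  have h21 : c2 ≤ c1 := Nat.choose_le_succ_of_lt_half_left (by omega)
  have h10 : c1 ≤ c0 := Nat.choose_le_succ_of_lt_half_left (by omega)
  have hA1 : c1 ≤ A := by
    rw [hA, Finset.sum_Ico_succ_top (show r + 3 ≤ r + s + 3 by omega), hsym]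
    exact Nat.le_add_left _ _
  have hc0pos : 0 < c0 := Nat.choose_pos (by omega)
  -- the inequality, in ℚ
  rw [hphi, hU, hY]
  have hpos : (0 : ℚ) < ((c2 + 2 * c1 + c0 : ℕ) : ℚ) := by exact_mod_cast (by omega : 0 < c2 + 2 * c1 + c0)
  rw [div_mul_eq_mul_div, div_le_iff₀ hpos]
  have q21 : (c2 : ℚ) ≤ c1 := by exact_mod_cast h21
  have q10 : (c1 : ℚ) ≤ c0 := by exact_mod_cast h10
  have qA1 : (c1 : ℚ) ≤ A := by exact_mod_cast hA1
  have qAD : (A : ℚ) = D := by exact_mod_cast hAD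
  have qBA : (B : ℚ) + c1 = A + c0 := by exact_mod_cast hBA
  have q2 : (0 : ℚ) ≤ c2 := by positivity
  push_cast
  nlinarith [mul_nonneg (sub_nonneg.2 (qA1.trans' q21)) (sub_nonneg.2 (q10.trans' q21)),
    mul_nonneg (sub_nonneg.2 (qA1.trans' q21)) (sub_nonneg.2 q21),
    mul_nonneg (sub_nonneg.2 q10) (sub_nonneg.2 (q10.trans' q21)),
    mul_nonneg q2 (sub_nonneg.2 q21)]

/-- `Φ(p, q) ≥ 0`. -/
lemma phiK_nonneg (p q : ℕ) : 0 ≤ phiK p q := by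
  unfold phiK; positivity

/-! ### Levels `q = 0` and `q = 1` -/

/-- Level `0`: `Φ(p, 0) ≤ #Y(p, 0, m)` for `m ≥ p − 2` (`#U = 1`). -/
theorem ladder_zero (t m : ℕ) (hm : t ≤ m) : phiK (t + 2) 0 ≤ (∑ a ∈ Ico (0 + 1) (t + 2), (m).choose a + 3 * ∑ a ∈ Ico (0) (t + 2 - 1), (m).choose a + 4 * ∑ a ∈ Ico (0 - 1) (t + 2 - 2), (m).choose a : ℕ) := by
  -- the base layer `m = t`
  have hbase : phiK (t + 2) 0 ≤ (∑ a ∈ Ico (0 + 1) (t + 2), (t).choose a + 3 * ∑ a ∈ Ico (0) (t + 2 - 1), (t).choose a + 4 * ∑ a ∈ Ico (0 - 1) (t + 2 - 2), (t).choose a : ℕ) := by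
    have hnum : ∑ u ∈ Ioo 0 (t + 2), (t + 2).choose u
        = ∑ a ∈ Ico 1 (t + 2), t.choose a + 2 * ∑ a ∈ Ico 0 (t + 1), t.choose a
          + ∑ a ∈ Ico 0 t, t.choose a := by
      rw [Ioo_eq_Ico', show (0 : ℕ) + 1 = 1 by rfl, show t + 2 = (t + 1) + 1 by rfl,
        sum_choose_succ' (t + 1) 1 (t + 1 + 1) (by omega), show (1 : ℕ) - 1 = 0 by rfl,
        show t + 1 + 1 - 1 = t + 1 by omega, sum_choose_succ' t 1 (t + 1 + 1) (by omega),
        show (1 : ℕ) - 1 = 0 by rfl, show t + 1 + 1 - 1 = t + 1 by omega,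
        sum_choose_succ_zero' t (t + 1) (by omega), show t + 1 - 1 = t by omega]
      ring
    have hY : (∑ a ∈ Ico (0 + 1) (t + 2), (t).choose a + 3 * ∑ a ∈ Ico (0) (t + 2 - 1), (t).choose a + 4 * ∑ a ∈ Ico (0 - 1) (t + 2 - 2), (t).choose a : ℕ) = ∑ a ∈ Ico 1 (t + 2), t.choose a + 3 * ∑ a ∈ Ico 0 (t + 1), t.choose a
        + 4 * ∑ a ∈ Ico 0 t, t.choose a := by
      simp only [show (0 : ℕ) + 1 = 1 by rfl, show t + 2 - 1 = t + 1 by omega, show (0 : ℕ) - 1 = 0 by rfl,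
        show t + 2 - 2 = t by omega]
    unfold phiK
    rw [show t + 2 + 0 = t + 2 by rfl, Nat.choose_self, Nat.cast_one, div_one, hY, ← Nat.cast_sum, hnum]
    exact_mod_cast (by omega : ∑ a ∈ Ico 1 (t + 2), t.choose a + 2 * ∑ a ∈ Ico 0 (t + 1), t.choose a
      + ∑ a ∈ Ico 0 t, t.choose a ≤ ∑ a ∈ Ico 1 (t + 2), t.choose a + 3 * ∑ a ∈ Ico 0 (t + 1), t.choose a
      + 4 * ∑ a ∈ Ico 0 t, t.choose a)
  -- monotone in `m`
  have hmono : ∀ k, (∑ a ∈ Ico (0 + 1) (t + 2), (t).choose a + 3 * ∑ a ∈ Ico (0) (t + 2 - 1), (t).choose a + 4 * ∑ a ∈ Ico (0 - 1) (t + 2 - 2), (t).choose a : ℕ) ≤ (∑ a ∈ Ico (0 + 1) (t + 2), (t + k).choose a + 3 * ∑ a ∈ Ico (0) (t + 2 - 1), (t + k).choose a + 4 * ∑ a ∈ Ico (0 - 1) (t + 2 - 2), (t + k).choose a : ℕ) := by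
    intro k
    induction k with
    | zero => simp
    | succ k ih => exact ih.trans (by rw [← Nat.add_assoc]; exact yC_zero_mono _ _)
  obtain ⟨k, rfl⟩ := Nat.exists_eq_add_of_le hm
  exact hbase.trans (by exact_mod_cast hmono k)

/-- Level `1`: `Φ(p, 1)·(3 + m) ≤ #Y(p, 1, m)` for `p ≥ 3`, `m ≥ p − 1`. -/
theorem ladder_one (t m : ℕ) (hm : t + 2 ≤ m) :
    phiK (t + 3) 1 * ((3 + m : ℕ) : ℚ) ≤ (∑ a ∈ Ico (1 + 1) (t + 3), (m).choose a + 3 * ∑ a ∈ Ico (1) (t + 3 - 1), (m).choose a + 4 * ∑ a ∈ Ico (1 - 1) (t + 3 - 2), (m).choose a : ℕ) := by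
  -- the base layer `m = t + 2`, `K = t + 2`
  have hbase : phiK (t + 3) 1 * ((3 + (t + 2) : ℕ) : ℚ) ≤ (∑ a ∈ Ico (1 + 1) (t + 3), (t + 2).choose a + 3 * ∑ a ∈ Ico (1) (t + 3 - 1), (t + 2).choose a + 4 * ∑ a ∈ Ico (1 - 1) (t + 3 - 2), (t + 2).choose a : ℕ) := by
    set A := ∑ a ∈ Ico 2 (t + 3), (t + 2).choose a with hA
    set B := ∑ a ∈ Ico 1 (t + 2), (t + 2).choose a with hB
    set D := ∑ a ∈ Ico 0 (t + 1), (t + 2).choose a with hD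
    have hnum : ∑ u ∈ Ioo 1 (t + 3), (t + 2 + 2).choose u = A + 2 * B + D := by
      rw [Ioo_eq_Ico', show (1 : ℕ) + 1 = 2 by rfl, show t + 2 + 2 = (t + 2 + 1) + 1 by rfl,
        sum_choose_succ' (t + 2 + 1) 2 (t + 3) (by omega), show (2 : ℕ) - 1 = 1 by rfl,
        show t + 3 - 1 = t + 2 by omega, sum_choose_succ' (t + 2) 2 (t + 3) (by omega),
        show (2 : ℕ) - 1 = 1 by rfl, show t + 3 - 1 = t + 2 by omega,
        sum_choose_succ' (t + 2) 1 (t + 2) (by omega), show (1 : ℕ) - 1 = 0 by rfl,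
        show t + 2 - 1 = t + 1 by omega]
      ring
    have hY : (∑ a ∈ Ico (1 + 1) (t + 3), (t + 2).choose a + 3 * ∑ a ∈ Ico (1) (t + 3 - 1), (t + 2).choose a + 4 * ∑ a ∈ Ico (1 - 1) (t + 3 - 2), (t + 2).choose a : ℕ) = A + 3 * B + 4 * D := by
      simp only [show (1 : ℕ) + 1 = 2 by rfl, show t + 3 - 1 = t + 2 by omega, show (1 : ℕ) - 1 = 0 by rfl,
        show t + 3 - 2 = t + 1 by omega]
      rfl
    have hAD : A = D := by
      rw [hA, hD, sum_choose_reflect (t + 2) 2 (t + 3) (by omega)]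
      rw [show t + 2 + 1 - (t + 3) = 0 by omega, show t + 2 + 1 - 2 = t + 1 by omega]
    have hBA : B + 1 = A + (t + 2) := by
      rw [hB, hA, Finset.sum_eq_sum_Ico_succ_bot (show 1 < t + 2 by omega),
        Finset.sum_Ico_succ_top (show 2 ≤ t + 2 by omega), Nat.choose_one_right, Nat.choose_self]
      ring
    unfold phiK
    rw [show t + 3 + 1 = t + 2 + 2 by rfl, ← Nat.cast_sum, hnum, hY,
      show (t + 2 + 2).choose (t + 3) = t + 4 from by
        rw [show t + 2 + 2 = (t + 3) + 1 by rfl]; exact Nat.choose_succ_self_right (t + 3)]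
    have hpos : (0 : ℚ) < ((t + 4 : ℕ) : ℚ) := by positivity
    rw [div_mul_eq_mul_div, div_le_iff₀ hpos]
    have qAD : (A : ℚ) = D := by exact_mod_cast hAD
    have qBA : (B : ℚ) + 1 = A + (t + 2) := by exact_mod_cast hBA
    have qA : (0 : ℚ) ≤ A := by positivity
    have qt : (0 : ℚ) ≤ t := by positivity
    push_cast
    nlinarith [mul_nonneg qA qt]
  -- the step `m → m + 1` through level `0` and Lemma E
  refine Nat.le_induction hbase (fun m' hm' ih => ?_) m hm
  have h0 := ladder_zero t m' (by omega)
  have hE : phiK (t + 3) 1 ≤ phiK (t + 2) 0 := phiK_succ_succ_le (t + 2) 0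
  rw [yC_one_succ t m', show 3 + (m' + 1) = (3 + m') + 1 by omega]
  push_cast at ih h0 ⊢
  nlinarith [ih, h0, hE, phiK_nonneg (t + 3) 1]

/-! ### The theorem at every level `q ≥ 2` -/

/-- The line-ladder inequality at level `q = r + 2`, rank `p = r + s + 4`, for every `m ≥ p + q − 2 = 2r + s + 4`. -/
theorem ladder_rs (r s : ℕ) :
    ∀ m, 2 * r + s + 4 ≤ m →
      phiK (r + s + 4) (r + 2) * ((4 * (m).choose (r + 2 - 2) + 3 * (m).choose (r + 2 - 1) + (m).choose (r + 2) : ℕ) : ℚ) ≤ (∑ a ∈ Ico (r + 2 + 1) (r + s + 4), (m).choose a + 3 * ∑ a ∈ Ico (r + 2) (r + s + 4 - 1), (m).choose a + 4 * ∑ a ∈ Ico (r + 2 - 1) (r + s + 4 - 2), (m).choose a : ℕ) := by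
  induction r with
  | zero =>
    intro m hm
    refine Nat.le_induction (by simpa using base_ineq 0 s) (fun m' hm' ih => ?_) m hm
    have h1 := ladder_one s m' (by omega)
    have hE : phiK (0 + s + 4) (0 + 2) ≤ phiK (s + 3) 1 := by
      simpa [show s + 3 + 1 = 0 + s + 4 by omega] using phiK_succ_succ_le (s + 3) 1
    have hU := uC_two_succ m'
    have hY := yC_succ 0 (s + 1) m'
    simp only [show s + 1 + 3 = 0 + s + 4 by omega, show s + 1 + 2 = s + 3 by omega, zero_add] at hY
    rw [hY, hU]
    have hnn : (0 : ℚ) ≤ ((3 + m' : ℕ) : ℚ) := by positivity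
    have hmul := mul_le_mul_of_nonneg_right hE hnn
    push_cast at ih h1 hmul ⊢
    nlinarith [ih, h1, hmul]
  | succ r ih =>
    intro m hm
    refine Nat.le_induction (by simpa using base_ineq (r + 1) s) (fun m' hm' ih' => ?_) m hm
    have hlow := ih m' (by omega)
    have hE : phiK (r + 1 + s + 4) (r + 1 + 2) ≤ phiK (r + s + 4) (r + 2) := by
      simpa [show r + s + 4 + 1 = r + 1 + s + 4 by omega, show r + 2 + 1 = r + 1 + 2 by omega]
        using phiK_succ_succ_le (r + s + 4) (r + 2)
    have hU := uC_succ r m'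
    simp only [show r + 3 = r + 1 + 2 by omega] at hU
    have hY := yC_succ (r + 1) (r + s + 2) m'
    simp only [show r + s + 2 + 3 = r + 1 + s + 4 by omega, show r + s + 2 + 2 = r + s + 4 by omega,
      show r + 1 + 1 = r + 2 by omega] at hY
    rw [hY, hU]
    have hnn : (0 : ℚ) ≤ ((4 * (m').choose (r + 2 - 2) + 3 * (m').choose (r + 2 - 1) + (m').choose (r + 2) : ℕ) : ℚ) := by positivity
    have hmul := mul_le_mul_of_nonneg_right hE hnn
    push_cast at ih' hlow hmul ⊢
    nlinarith [ih', hlow, hmul]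

/-- **THE LINE-LADDER INEQUALITY** (the arithmetic half of the theorem of `proofs/P9-S4-LINELADDER-g13.md`): for every
level `q ≥ 2`, every `p ≥ q + 2` and every `m ≥ p + q − 2`,
`Φ(p,q) · (4·C(m, q−2) + 3·C(m, q−1) + C(m, q)) ≤ Σ_{q<a<p} C(m,a) + 3·Σ_{q≤a≤p−2} C(m,a) + 4·Σ_{q−1≤a≤p−3} C(m,a)` —
the two sides being `#U` and `#Y` of `T_p(U_{2,3} ⊕ U_{m,m})` at `(p, q)` (Lemma 1 of the note; the matroid bridge is
not in this file). -/
theorem ladder_ineq (p q m : ℕ) (hq : 2 ≤ q) (hpq : q + 2 ≤ p) (hm : p + q - 2 ≤ m) :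
    phiK p q * ((4 * (m).choose (q - 2) + 3 * (m).choose (q - 1) + (m).choose (q) : ℕ) : ℚ) ≤ (∑ a ∈ Ico (q + 1) (p), (m).choose a + 3 * ∑ a ∈ Ico (q) (p - 1), (m).choose a + 4 * ∑ a ∈ Ico (q - 1) (p - 2), (m).choose a : ℕ) := by
  obtain ⟨r, rfl⟩ : ∃ r, q = r + 2 := ⟨q - 2, by omega⟩
  obtain ⟨s, rfl⟩ : ∃ s, p = r + s + 4 := ⟨p - r - 4, by omega⟩
  exact ladder_rs r s m (by omega)

end PercRepro.LineLadder
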